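import Summits.MatrixMultiplication.MatrixMultiplication.Theses.FarEdgeDescent
import Summits.MatrixMultiplication.MatrixMultiplication.Theorems.FarEdgeDescentTower

/-!
# Route `FarEdgeDescent` — item `PowerAmortisation` (stmt-MatrixMultiplication-25347), PROVED

decomp-mm ROOT cell (D-0178), lens 2 «structural dichotomy: special vs generic», gen 48 (kernel XXIV-b).
Node of record UNCHANGED: `closes (h₁ : FiniteSaturation) (h₂ : AnchoredLogConvexity) : MatrixMultiplication`;
`FiniteSaturation` is split into `PowerAmortisation ∧ OctaveFlatness` (glue `FarEdgeDescentGlue.finiteSaturationGlue`,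
landed).  THIS FILE closes the child `PowerAmortisation` BY NAME:

  `∃ δ > 0, ∃ C, ∀ k ≥ 1:  ω(1,k,1) − (k+1) ≤ C·k^{−δ}`   — with `δ = 1/4`, `C = 3`, over `ℂ`,

from the THESES-FREE border-rank tower `Theorems/FarEdgeDescentTower.lean` (`powerAmortisation_bound`, every
field): the crude Coppersmith–Winograd augmentation for arbitrary approximate algorithms, ITERATED ON ITS OWN
OUTPUT in border rank (certificate `bR(⟨c⟩ ⊗ ⟨A,M,A⟩) ≤ 29·cAM` ↦ the same certificate for
`⟨(15c)²⟩ ⊗ ⟨A², (M·(28cAM)¹⁴)², A²⟩`; base `⟨1⟩ ⊗ ⟨29,1,29⟩`), read out at the far edge by the rectangular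
asymptotic sum inequality with multiplicity: `e(k) ≤ 2^{−j}` for `k ≥ 3·15^j − 3`.  The special-side rate
ladder of the route now reads `LogRate (25370) < LogRateSharp (33239) < SubLogRate (25371) < PowerAmortisation
(25347, THIS FILE)`, all proved; what remains of the special crux `FiniteSaturation` is its other child
`OctaveFlatness` (`e(k) ≤ l·e(2k)` eventually, every `l > 1`), i.e. that the excess does not decay FASTER than
every power along octaves — the tower gives decay at least `k^{−log 2/log 15}`, an upper bound only.
NO definitions (gate rule D-0009). [cite: CoppersmithWinograd1982, Thm. 1] [cite: KnuthTAOCP2, §4.6.4, Ex. 67(e),(g)]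
[cite: LottiRomani1983, Prop. 3.3, Prop. 4.1]
-/

set_option linter.dupNamespace false

noncomputable section

namespace Summit.MatrixMultiplication.MatrixMultiplication.Theorems.FarEdgeDescentPowerAmortisation

/-- **`PowerAmortisation` holds** (item stmt-MatrixMultiplication-25347 of `route-MatrixMultiplication-FarEdgeDescent`,
by name): there are `δ > 0` and `C` with `ω(1,k,1) − (k+1) ≤ C·k^{−δ}` for every integer `k ≥ 1` — namely
`δ = 1/4`, `C = 3`, by the border-rank tower `FarEdgeDescentTower.powerAmortisation_bound` at `K = ℂ`.
[cite: CoppersmithWinograd1982, Thm. 1] [cite: LottiRomani1983, Prop. 4.1] -/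
theorem powerAmortisation :
    Summit.MatrixMultiplication.MatrixMultiplication.Theses.FarEdgeDescent.PowerAmortisation :=
  Summit.MatrixMultiplication.MatrixMultiplication.Theorems.FarEdgeDescentTower.powerAmortisation_bound ℂ

end Summit.MatrixMultiplication.MatrixMultiplication.Theorems.FarEdgeDescentPowerAmortisation

end
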